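import Summits.BirchSwinnertonDyer.BirchSwinnertonDyer.Theorems.SignedLowerHalvesSmallImageLowerHalfBothSignsRttCharRoadLocalShape
import Literature.NumberTheory.QuadraticFields.RingClassNumberFormula
import Literature.NumberTheory.LFunctions.RayClassCharacter
import HarnessLib

/-!
# Route `SignedLowerHalves`, crux L `SmallImageLowerHalfBothSigns` (item stmt-BirchSwinnertonDyer-23599), line `rtt_w3` v8 —
# preparatory lemmas for row J-glue (JD ⟸ J-char ∧ J-curve; spec `Cruxes/…/Lines/rtt_w3_JGLUE_spec.lean`)

LEAD `cruxlead-stmt-BirchSwinnertonDyer-23599` g5; helper `--supports stmt-BirchSwinnertonDyer-23599`; THEOREMS ONLY, no `sorry`; closes nothing;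
BSD / crux L / J are not proved by this.

The J-glue (spec: `charRoadJD_of_curveSide`) matches the curve side `χW(w) = art(w)·(−p)^{deg w}` with the character side
`θ(res w) = e⁻¹(ψ v)^{deg w}·f₀(art w)` (J-char p761160). Four of its elementary inputs, isolated here:
* `psi_eq_neg_natCast_of_asIdeal_eq_span` — ON THE CRUX'S BINDERS `ψ(𝔭) = −p` at the inert `𝔭 = (p)`: centrality `ψ((n)) = (d_K/n)·n` at `n = p`
  (odd, prime to `d_K·N𝔪`), `idealPow_asIdeal`, and `(d_K/p) = −1` ⟺ `(p)` prime (`RingClass.isPrime_span_natCast_iff_jacobiSym_eq_neg_one`);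
  hence `e⁻¹(ψ 𝔭) = −p` in `ℚ̄_p` (`symm_psi_eq_neg_natCast`);
* `eq_of_natCast_mem_of_asIdeal_eq_span` — `(p)` prime ⇒ it is the ONLY place above `p` (input of `exists_continuous_localEmbedding_of_forall_eq`);
* `not_le_asIdeal_of_card_quot` — `#(𝓞_K/𝔭) = p²` and `p ∤ d_K·N𝔪` ⇒ `𝔪 ≰ 𝔭` (the `¬ 𝔪 ≤ v` input of J-char's local clause);
* `smul_cofreeMk_of_rank_one` — for a RANK-ONE framed `θ`, `g ∈ G` acts on `(F/𝒪)(θ) = Cofree θ F` by the scalar `θ(g)₀₀ ∈ 𝒪` (the shape in which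
  the equivariance of `j = (f₀ mod 𝒪) ∘ α` is checked).

References: [Cox2013, §5.B Prop. 5.16]; [NeukirchANT1999, Ch. VII §6]; [EmertonPollackWeston2006, §3.1].
-/

set_option autoImplicit false
-- D-0017: single-problem summit, the namespace repeats the problem name by design.
set_option linter.dupNamespace false
noncomputable section

open scoped NumberField MatrixGroups
open NumberField IsDedekindDomain Polynomial Field
  Literature.NumberTheory.GaloisRepresentations Literature.NumberTheory.LFunctions
  Literature.NumberTheory.EllipticCurves Literature.NumberTheory.QuadraticFields

namespace Summit.BirchSwinnertonDyer.BirchSwinnertonDyer.Theorems.SmallImageRttCharRoad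

/-! ## §1 Arithmetic of the inert place on the crux's binders -/

section Inert

variable {K : Type} [Field K] [NumberField K]

/-- **`ψ(𝔭) = −p` at the inert `𝔭 = (p)`** from the centrality clause `ψ((n)) = (d_K/n)·n^{2−1}` (odd `n` prime to `d_K·N𝔪`) of the crux's
exported Grössencharakter, `p ∤ d_K·N𝔪`, and the decomposition law `(p)` prime ⟺ `(d_K/p) = −1`. [cite: Cox2013, §5.B Prop. 5.16, p. 105] -/
theorem psi_eq_neg_natCast_of_asIdeal_eq_span (hK2 : Module.finrank ℚ K = 2) {p : ℕ} [Fact p.Prime] (hp : p ≠ 2)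
    {𝔪 : Ideal (𝓞 K)} {ψ : HeightOneSpectrum (𝓞 K) → ℂ}
    (hneb : ∀ n : ℕ, Odd n → n.Coprime ((NumberField.discr K).natAbs * Ideal.absNorm 𝔪) →
      idealPow K ψ (Ideal.span {(n : 𝓞 K)}) = (jacobiSym (NumberField.discr K) n : ℂ) * (n : ℂ) ^ (2 - 1))
    (hpD : ¬ p ∣ (NumberField.discr K).natAbs * Ideal.absNorm 𝔪)
    {v : HeightOneSpectrum (𝓞 K)} (hv : v.asIdeal = Ideal.span {(p : 𝓞 K)}) : ψ v = -(p : ℂ) := by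
  have hp' : p.Prime := Fact.out
  have h1 := hneb p (hp'.odd_of_ne_two hp) ((Nat.Prime.coprime_iff_not_dvd hp').2 hpD)
  rw [← hv, idealPow_asIdeal] at h1
  have hprime : (Ideal.span {(p : 𝓞 K)}).IsPrime := hv ▸ v.isPrime
  have hj := (RingClass.isPrime_span_natCast_iff_jacobiSym_eq_neg_one hK2 hp' hp).1 hprime
  rw [h1, hj]
  push_cast
  ring

/-- Hence `e⁻¹(ψ 𝔭) = −p` in `ℚ̄_p` for every `e : ℚ̄_p ≃ ℂ`. [cite: Cox2013, §5.B Prop. 5.16, p. 105] -/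
theorem symm_psi_eq_neg_natCast (hK2 : Module.finrank ℚ K = 2) {p : ℕ} [Fact p.Prime] (hp : p ≠ 2)
    {𝔪 : Ideal (𝓞 K)} {ψ : HeightOneSpectrum (𝓞 K) → ℂ}
    (hneb : ∀ n : ℕ, Odd n → n.Coprime ((NumberField.discr K).natAbs * Ideal.absNorm 𝔪) →
      idealPow K ψ (Ideal.span {(n : 𝓞 K)}) = (jacobiSym (NumberField.discr K) n : ℂ) * (n : ℂ) ^ (2 - 1))
    (hpD : ¬ p ∣ (NumberField.discr K).natAbs * Ideal.absNorm 𝔪)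
    {v : HeightOneSpectrum (𝓞 K)} (hv : v.asIdeal = Ideal.span {(p : 𝓞 K)}) (e : PadicAlgCl p ≃+* ℂ) :
    e.symm (ψ v) = -(p : PadicAlgCl p) := by
  rw [psi_eq_neg_natCast_of_asIdeal_eq_span hK2 hp hneb hpD hv, map_neg, map_natCast]

omit [NumberField K] in
/-- **`(p)` prime ⇒ it is the only place above `p`** (maximality of nonzero primes in a Dedekind domain).
[cite: NeukirchANT1999, Ch. I §3 Thm. (3.1)] -/
theorem eq_of_natCast_mem_of_asIdeal_eq_span [NumberField K] {p : ℕ} {v w : HeightOneSpectrum (𝓞 K)}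
    (hv : v.asIdeal = Ideal.span {(p : 𝓞 K)}) (hw : (p : 𝓞 K) ∈ w.asIdeal) : w = v := by
  have hle : v.asIdeal ≤ w.asIdeal := by
    rw [hv, Ideal.span_le, Set.singleton_subset_iff]
    exact hw
  exact HeightOneSpectrum.ext (((v.isPrime.isMaximal v.ne_bot).eq_of_le w.isPrime.ne_top hle).symm)

/-- **`𝔪 ≰ 𝔭`** when `#(𝓞_K/𝔭) = p²` and `p ∤ d_K·N𝔪` (`N𝔭 = p² ∣ N𝔪` otherwise). [cite: NeukirchANT1999, Ch. I §6] -/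
theorem not_le_asIdeal_of_card_quot {p : ℕ} [Fact p.Prime] {𝔪 : Ideal (𝓞 K)} {v : HeightOneSpectrum (𝓞 K)}
    (hcard : Nat.card (𝓞 K ⧸ v.asIdeal) = p ^ 2) (hpD : ¬ p ∣ (NumberField.discr K).natAbs * Ideal.absNorm 𝔪) :
    ¬ 𝔪 ≤ v.asIdeal := by
  intro h
  have hdvd : Ideal.absNorm v.asIdeal ∣ Ideal.absNorm 𝔪 := Ideal.absNorm_dvd_absNorm_of_le h
  rw [Ideal.absNorm_apply, Submodule.cardQuot_apply, hcard] at hdvd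
  exact hpD (Dvd.dvd.mul_left ((dvd_pow_self p two_ne_zero).trans hdvd) _)

end Inert

/-! ## §2 The rank-one cofree module: the Galois action is scalar -/

section RankOne

variable {G : Type*} [Group G] [TopologicalSpace G] {𝒪 : Type*} [CommRing 𝒪] [TopologicalSpace 𝒪]
  (F : Type*) [Field F] [Algebra 𝒪 F]

/-- **On `(F/𝒪)(θ) = Cofree θ F` for a RANK-ONE framed `θ`, `g` acts by the scalar `θ(g)₀₀ ∈ 𝒪`** (`smul_cofreeMk`, `mulVec` on `Fin 1`).
[cite: EmertonPollackWeston2006, §3.1 (arXiv:math/0404484 p. 17)] -/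
theorem smul_cofreeMk_of_rank_one (θ : FramedRep G 𝒪 1) (g : G) (x : Fin 1 → F) :
    g • GreenbergSelmer.cofreeMk F θ x =
      (((θ g : GL (Fin 1) 𝒪) : Matrix (Fin 1) (Fin 1) 𝒪) 0 0) • GreenbergSelmer.cofreeMk F θ x := by
  rw [GreenbergSelmer.smul_cofreeMk, ← map_smul]
  congr 1
  ext i
  rw [GreenbergSelmer.fracRepresentation_apply_apply, Matrix.mulVec, dotProduct, Fin.sum_univ_one, Pi.smul_apply,
    Matrix.map_apply, Fin.eq_zero i, Algebra.smul_def]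

end RankOne

end Summit.BirchSwinnertonDyer.BirchSwinnertonDyer.Theorems.SmallImageRttCharRoad

end
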